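import Summits.AtomisticToContinuum.HydrodynamicLimit.Theorems.RelayRaceLocalityNearConstantShortTimeHLGoodEventPackage
import Summits.AtomisticToContinuum.HydrodynamicLimit.Theorems.RelayRaceLocalityNearConstantShortTimeHLGoodEventsI
import Summits.AtomisticToContinuum.HydrodynamicLimit.Theorems.RelayRaceLocalityNearConstantShortTimeHLPackQuarticDefs
import HarnessLib

/-!
# Crux `NearConstantShortTimeHL` (stmt-AtomisticToContinuum-12502), line `small-tilt-domination`, skeleton v18 (lead c8):
# `good_event_packagePQ` — the good events under the packing + integrated fourth-moment caps (NO SPEED CAP)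

Support file (`--supports stmt-AtomisticToContinuum-12502`). Skeleton v18 re-types the equilibrium closure K-stubs with the INTEGRATED
fourth-moment cap `∫_{window} n⁻¹ Σᵢ ‖vᵢ(r)‖⁴ dr ≤ K` in the conditioning event and a rate uniform in the cap level
(`MomentumClosureTightnessI` / `EnergyClosureTightnessI`, `…IntCapDefs`), so that the a-priori input `FourthMomentCapPreShock` of v14 is no
longer needed: along the true law the integrated cap on `[0, t]` fails at level `K` with probability `≤ C₄ / K` (Tonelli + Markov from the
Gaussian tails in mean, `intFourthMoment_markov`). This file re-proves level 1a of the Grönwall assembly in that currency: the landed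
`good_event_package4` (p138131) VERBATIM, with (i) the conjunct `intMomentCapOn (Φ N) z window (Kc i)` in the four families of closure-defect
events of grid size `i`, at the cap level `Kc i := 2 (C₄ + 1)(i + 1) → ∞` TIED TO THE GRID INDEX, (ii) the bad sets INDEXED by `i` — speed-cap
failure, packing-cap failure, and `{ofReal (Kc i) < ∫⁻_{[0,t]} n⁻¹ Σᵢ ‖vᵢ(r)‖⁴}` — of mass eventually `≤ 1/(i+1) + C₄/(Kc i) =: b i → 0`, fed to
the indexed good-event extraction `exists_goodEvents_of_importI` (p147928), (iii) the integrated cap on `[0, t]` read off the good event and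
restricted to the windows / cells (`intMomentCapOn_mono`). Same conclusion as `good_event_package4`, so the dynamic theorem (`…DynamicI`) is
the landed proof of `dynamic_theorem4` over this package. All the `xx_*` helpers are the landed ones (`…GoodEventPackage`).
References: H.-T. Yau, Lett. Math. Phys. 22 (1991) §2.
-/

noncomputable section

namespace Summit.AtomisticToContinuum.HydrodynamicLimit.Theorems.NearConstantShortTimeHL

open scoped BigOperators ENNReal
open MeasureTheory Set Filter Topology
open Literature.MathematicalPhysics.KineticTheory Literature.Analysis.FluidPDE Literature.Analysis.FunctionSpaces

/-- **`good_event_packagePQ` — the good events WITHOUT THE SPEED CAP (level 1a of the Grönwall assembly of skeleton v20).** Verbatim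
`good_event_packageI` with the speed cap removed from the closure events, from the bad sets and from the good-event clause. ORIGINAL DOC: Verbatim `good_event_package4` with the integrated cap `intMomentCapOn … K` in the conditioning events of the closure bounds `hKmom` /
`hKen` (now for EVERY level `K > 0`), and the sup-cap failure limit replaced by the Markov-rate bound `P N {ofReal K < ∫⁻_{[0,t]} n⁻¹Σᵢ‖vᵢ‖⁴}
≤ ofReal (C₄ / K)` (eventually in `N`, for every `K > 0`); same conclusion: a `C¹` constant `Λ` of the log-profile rows, a diagonal grid index
`ι(N) → ∞`, measurable good events `G' N` with `P N (G' N)ᶜ → 0`, and eventually `0 < ι N`, `0 < ℓ_N < 1/2`, the modulus `1/(ι N + 1)` of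
`∂ₜλ⁰, ∂ₜλ, ∂ₜλ⁴, ∇λ⁰` at scale `ℓ_N` on `[0, t]`, and on `G' N` the speed and packing caps on `[0, t]` together with the closure-defect
bounds `2Λ/(ι N + 1)²` for the plain rows on the windows `[0, (k+1)t/ι]` and the time-weighted rows on the cells `[jt/ι, (j+1)t/ι]` (event
import + closure K-stubs at level `Kc (ι N)` + indexed cap failures, through `exists_goodEvents_of_importI`). [cite: Yau1991, §2] -/
theorem good_event_packagePQ : ∀ {η₀ : ℝ} {F : ℝ → ℝ}, 0 < η₀ → AnalyticOnNhd ℝ F (Set.Ioo (-η₀) η₀) → Set.EqOn hsExcessFreeEnergy F (Set.Ico 0 η₀) → ∀ {σ T : ℝ}, 0 < σ → ∀ {ρ θ : ℝ → T3 → ℝ} {u : ℝ → T3 → V3}, IsHardSphereEulerSolution σ T ρ u θ → ∀ {t : ℝ}, t ∈ Set.Ico 0 T → 0 < t → t < 1 → (∀ s ∈ Set.Icc 0 t, ∀ x, ρ s x * σ ^ 3 < η₀) → ∀ {ηP : ℝ} {ε : ℕ → ℝ} {n : ℕ → ℕ}, Tendsto n atTop atTop → ∀ (Φ : (N : ℕ)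 → HardSphereFlow (Torus.geometry (Fin 3)) (ε N) (n N)) (P G : (N : ℕ) → Measure (Config (n N) (Fin 3) T3)) {aI c₀ : ℝ}, aI < c₀ → (∀ N (S : Set (Config (n N) (Fin 3) T3)), P N S ≤ ENNReal.ofReal (Real.exp (aI * n N)) * G N S) → ∀ {η₂ η₃ : ℝ}, ηP ≤ η₂ → ηP ≤ η₃ → (∀ K : ℝ, 0 < K → ∀ (s τ : ℝ), 0 ≤ s → 0 < τ → s + τ ≤ 1 → ∀ ψ : ℝ → T3 → V3, Torus.IsSmoothSpaceTimeOn (Set.Icc s (s + τ)) ψ → (∀ r ∈ Set.Icc s (s + τ), ∀ x, ‖ψ r x‖ ≤ 1 ∧ ‖Torus.timeDerivWithin (Set.Icc s (s + τ)) ψ r x‖ ≤ 1 ∧ ∀ i, ‖Torus.partialDeriv i (ψ r) x‖ ≤ 1) → ∀ δ : ℝ, 0 < δ → ∀ᶠ N : ℕ in atTop, G N {z | packCapOn (Φ N) z (Set.Icc s (s + τ)) (mesoRadius (n N)) σ η₂ ∧ intMomentCapOn (Φ N) z (Set.Icc s (s + τ)) K ∧ δ < |momDefect σ (Φ N) z (mesoRadius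 (n N)) s τ ψ|} ≤ ENNReal.ofReal (Real.exp (-(c₀ * n N)))) → (∀ K : ℝ, 0 < K → ∀ (s τ : ℝ), 0 ≤ s → 0 < τ → s + τ ≤ 1 → ∀ φ : ℝ → T3 → ℝ, Torus.IsSmoothSpaceTimeOn (Set.Icc s (s + τ)) φ → (∀ r ∈ Set.Icc s (s + τ), ∀ x, |φ r x| ≤ 1 ∧ |Torus.timeDerivWithin (Set.Icc s (s + τ)) φ r x| ≤ 1 ∧ ∀ i, |Torus.partialDeriv i (φ r) x| ≤ 1) → ∀ δ : ℝ, 0 < δ → ∀ᶠ N : ℕ in atTop, G N {z | packCapOn (Φ N) z (Set.Icc s (s + τ)) (mesoRadius (n N)) σ η₃ ∧ intMomentCapOn (Φ N) z (Set.Icc s (s + τ)) K ∧ δ < |enDefect σ (Φ N) z (mesoRadius (n N)) s τ φ|} ≤ ENNReal.ofReal (Real.exp (-(c₀ * n N)))) → Tendsto (fun N => P N {z | ∃ r ∈ Set.Icc 0 t, ∃ x : T3, ηP < empiricalDensityField ((Φ N).flow r z) (ballKernel (mesoRadius (n N)) x) * σ ^ 3}) atTop (nhds 0) → ∀ {C₄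 : ℝ}, 0 ≤ C₄ → (∀ K : ℝ, 0 < K → ∀ᶠ N : ℕ in atTop, P N {z | ENNReal.ofReal K < ∫⁻ r in Set.Icc 0 t, ENNReal.ofReal ((n N : ℝ)⁻¹ * ∑ i : Fin (n N), ‖((Φ N).flow r z i).2‖ ^ 4)} ≤ ENNReal.ofReal (C₄ / K)) → ∃ Λ : ℝ, 0 < Λ ∧ ∃ ι : ℕ → ℕ, Tendsto ι atTop atTop ∧ ∃ G' : (N : ℕ) → Set (Config (n N) (Fin 3) T3), (∀ N, MeasurableSet (G' N)) ∧ Tendsto (fun N => P N (G' N)ᶜ) atTop (nhds 0) ∧ ∀ᶠ N in atTop, 0 < ι N ∧ 0 < mesoRadius (n N) ∧ mesoRadius (n N) < 1 / 2 ∧ (∀ r ∈ Set.Icc 0 t, ∀ x y : T3, Torus.euclidDist x y < mesoRadius (n N) → |Torus.timeDerivWithin (Set.Ico 0 T) (lam0Row σ ρ θ u) r x - Torus.timeDerivWithin (Set.Ico 0 T) (lam0Row σ ρ θ u) r y| ≤ ((ι N : ℝ) + 1)⁻¹ ∧ ‖Torus.timeDerivWithin (Set.Ico 0 T) (lamRow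 θ u) r x - Torus.timeDerivWithin (Set.Ico 0 T) (lamRow θ u) r y‖ ≤ ((ι N : ℝ) + 1)⁻¹ ∧ |Torus.timeDerivWithin (Set.Ico 0 T) (lam4Row θ) r x - Torus.timeDerivWithin (Set.Ico 0 T) (lam4Row θ) r y| ≤ ((ι N : ℝ) + 1)⁻¹ ∧ ∀ k, |Torus.partialDeriv k (lam0Row σ ρ θ u r) x - Torus.partialDeriv k (lam0Row σ ρ θ u r) y| ≤ ((ι N : ℝ) + 1)⁻¹) ∧ ∀ z ∈ G' N, z ∈ (Φ N).good → packCapOn (Φ N) z (Set.Icc 0 t) (mesoRadius (n N)) σ ηP ∧ (∀ k : ℕ, k < ι N → |momDefect σ (Φ N) z (mesoRadius (n N)) 0 ((k + 1) * (t / ι N)) (lamRow θ u)| ≤ 2 * Λ / ((ι N : ℝ) + 1) ^ 2 ∧ |enDefect σ (Φ N) z (mesoRadius (n N)) 0 ((k + 1) * (t / ι N)) (lam4Row θ)| ≤ 2 * Λ / ((ι N : ℝ) + 1) ^ 2) ∧ (∀ j : ℕ, j < ι N → |momDefect σ (Φ N) z (mesoRadius (n N)) (j * (t / ι N)) (t /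 ι N) (fun r y => (j * (t / ι N) + t / ι N - r) • lamRow θ u r y)| ≤ 2 * Λ / ((ι N : ℝ) + 1) ^ 2 ∧ |enDefect σ (Φ N) z (mesoRadius (n N)) (j * (t / ι N)) (t / ι N) (fun r y => (j * (t / ι N) + t / ι N - r) * lam4Row θ r y)| ≤ 2 * Λ / ((ι N : ℝ) + 1) ^ 2) := by
  intro η₀ F hη₀ hFa hEqF σ T hσ ρ θ u hE t ht ht0 ht1 hband ηP ε n hn Φ P G aI c₀ hac hImp η₂ η₃ hη₂ hη₃
    hKmom hKen hW C₄ hC₄ hcapI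
  -- the cap levels `Kc i := 2 (C₄ + 1) (i + 1) → ∞` along the grid index (so that `C₄ / Kc i ≤ 1/(2(i+1))`)
  set Kc : ℕ → ℝ := fun i => 2 * (C₄ + 1) * ((i : ℝ) + 1) with hKc_def
  have hKc : ∀ i, 0 < Kc i := fun i => by simp only [hKc_def]; positivity
  -- (0) horizon `T'`, smooth rows on `[0, T')`, `C¹` bounds `Λ` and moduli radii on `[0, t]`
  obtain ⟨T', htT', hT'T, hband'⟩ := exists_horizon_of_packing_lt hE hσ ht hband
  obtain ⟨hlam0, hlam, hlam4⟩ : Torus.IsSmoothSpaceTimeOn (Set.Ico 0 T') (lam0Row σ ρ θ u) ∧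
      Torus.IsSmoothSpaceTimeOn (Set.Ico 0 T') (lamRow θ u) ∧
      Torus.IsSmoothSpaceTimeOn (Set.Ico 0 T') (lam4Row θ) :=
    isSmoothSpaceTimeOn_logProfileRows hη₀ hFa hEqF hσ hE hT'T hband'
  obtain ⟨-, hm0⟩ := exists_bounds_moduli_of_isSmoothSpaceTimeOn hlam0 ht.1 htT'
  obtain ⟨⟨Λ₁, hΛ₁, hb1, -⟩, hm1⟩ := exists_bounds_moduli_of_isSmoothSpaceTimeOn hlam ht.1 htT'
  obtain ⟨⟨Λ₄, -, hb4, -⟩, hm4⟩ := exists_bounds_moduli_of_isSmoothSpaceTimeOn hlam4 ht.1 htT'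
  obtain ⟨Λ, hΛ1, hΛ4, hΛpos⟩ : ∃ Λ : ℝ, Λ₁ ≤ Λ ∧ Λ₄ ≤ Λ ∧ 0 < Λ :=
    ⟨max Λ₁ Λ₄, le_max_left _ _, le_max_right _ _, lt_max_of_lt_left hΛ₁⟩
  have h2Λ : 0 < 2 * Λ := by positivity
  have hBΛ1 : ∀ r ∈ Set.Icc 0 t, ∀ x, ‖lamRow θ u r x‖ ≤ Λ ∧
      ‖Torus.timeDerivWithin (Set.Ico 0 T') (lamRow θ u) r x‖ ≤ Λ ∧
      ∀ i, ‖Torus.partialDeriv i (lamRow θ u r) x‖ ≤ Λ := fun r hr x =>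
    ⟨(hb1 r hr x).1.trans hΛ1, (hb1 r hr x).2.1.trans hΛ1, fun i => ((hb1 r hr x).2.2 i).trans hΛ1⟩
  have hBΛ4 : ∀ r ∈ Set.Icc 0 t, ∀ x, ‖lam4Row θ r x‖ ≤ Λ ∧
      ‖Torus.timeDerivWithin (Set.Ico 0 T') (lam4Row θ) r x‖ ≤ Λ ∧
      ∀ i, ‖Torus.partialDeriv i (lam4Row θ r) x‖ ≤ Λ := fun r hr x =>
    ⟨(hb4 r hr x).1.trans hΛ4, (hb4 r hr x).2.1.trans hΛ4, fun i => ((hb4 r hr x).2.2 i).trans hΛ4⟩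
  have he : ∀ i : ℕ, (0 : ℝ) < ((i : ℝ) + 1)⁻¹ := fun i => by positivity
  have hδ : ∀ i : ℕ, (0 : ℝ) < ((i : ℝ) + 1)⁻¹ ^ 2 := fun i => by positivity
  choose d0 hd0 hmod0 using hm0
  choose d1 hd1 hmod1 using hm1
  choose d4 hd4 hmod4 using hm4
  obtain ⟨dd, hdd⟩ : ∃ dd : ℕ → ℝ, ∀ i, dd i = min (d0 _ (he i)) (min (d1 _ (he i)) (d4 _ (he i))) :=
    ⟨_, fun _ => rfl⟩
  have hddpos : ∀ i, 0 < dd i := fun i => by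
    rw [hdd]
    exact lt_min (hd0 _ _) (lt_min (hd1 _ _) (hd4 _ _))
  -- the admissible normalised tests on the windows `[0, (j+1)t/i]` and the cells `[jt/i, (j+1)t/i]`, `j < i`
  have hw := fun (i j : ℕ) (hij : j < i) => xx_window ht0 ht1 htT' hij
  have hcl := fun (i j : ℕ) (hij : j < i) => xx_cell ht0 ht1 htT' hij
  have adm0 := fun (i j : ℕ) (hij : j < i) => xx_rowTest_admissible hlam le_rfl (hw i j hij).2.1
    (hw i j hij).2.2.1 hΛpos fun r hr x => hBΛ1 r ((hw i j hij).2.2.2.2 hr) x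
  have adm1 := fun (i j : ℕ) (hij : j < i) => xx_rowTest_admissible hlam4 le_rfl (hw i j hij).2.1
    (hw i j hij).2.2.1 hΛpos fun r hr x => hBΛ4 r ((hw i j hij).2.2.2.2 hr) x
  have adm2 := fun (i j : ℕ) (hij : j < i) => xx_weightedRowTest_admissible hlam (hcl i j hij).1
    (hcl i j hij).2.2.1 (hcl i j hij).2.2.2.1 (hcl i j hij).2.2.2.2.1 hΛpos
    fun r hr x => hBΛ1 r ((hcl i j hij).2.2.2.2.2.2 hr) x
  have adm3 := fun (i j : ℕ) (hij : j < i) => xx_weightedRowTest_admissible hlam4 (hcl i j hij).1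
    (hcl i j hij).2.2.1 (hcl i j hij).2.2.2.1 (hcl i j hij).2.2.2.2.1 hΛpos
    fun r hr x => hBΛ4 r ((hcl i j hij).2.2.2.2.2.2 hr) x
  -- (1) the closure-defect events of grid size `i`: type `q % 4`, window/cell index `q / 4`
  obtain ⟨E, hE⟩ : ∃ E : ℕ → ℕ → (N : ℕ) → Set (Config (n N) (Fin 3) T3), ∀ i q N, E i q N =
      if q % 4 = 0 then
        {z | packCapOn (Φ N) z (Set.Icc 0 (0 + (((q / 4 : ℕ) : ℝ) + 1) * (t / i))) (mesoRadius (n N)) σ η₂ ∧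
          intMomentCapOn (Φ N) z (Set.Icc 0 (0 + (((q / 4 : ℕ) : ℝ) + 1) * (t / i))) (Kc i) ∧
          ((i : ℝ) + 1)⁻¹ ^ 2 < |momDefect σ (Φ N) z (mesoRadius (n N)) 0 ((((q / 4 : ℕ) : ℝ) + 1) * (t / i))
            (fun r y => Λ⁻¹ • lamRow θ u r y)|}
      else if q % 4 = 1 then
        {z | packCapOn (Φ N) z (Set.Icc 0 (0 + (((q / 4 : ℕ) : ℝ) + 1) * (t / i))) (mesoRadius (n N)) σ η₃ ∧
          intMomentCapOn (Φ N) z (Set.Icc 0 (0 + (((q / 4 : ℕ) : ℝ) + 1) * (t / i))) (Kc i) ∧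
          ((i : ℝ) + 1)⁻¹ ^ 2 < |enDefect σ (Φ N) z (mesoRadius (n N)) 0 ((((q / 4 : ℕ) : ℝ) + 1) * (t / i))
            (fun r y => Λ⁻¹ • lam4Row θ r y)|}
      else if q % 4 = 2 then
        {z | packCapOn (Φ N) z (Set.Icc (((q / 4 : ℕ) : ℝ) * (t / i)) (((q / 4 : ℕ) : ℝ) * (t / i) + t / i))
            (mesoRadius (n N)) σ η₂ ∧
          intMomentCapOn (Φ N) z (Set.Icc (((q / 4 : ℕ) : ℝ) * (t / i)) (((q / 4 : ℕ) : ℝ) * (t / i) + t / i)) (Kc i) ∧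
          ((i : ℝ) + 1)⁻¹ ^ 2 < |momDefect σ (Φ N) z (mesoRadius (n N)) (((q / 4 : ℕ) : ℝ) * (t / i)) (t / i)
            (fun r y => (2 * Λ)⁻¹ • ((((q / 4 : ℕ) : ℝ) * (t / i) + t / i - r) • lamRow θ u r y))|}
      else
        {z | packCapOn (Φ N) z (Set.Icc (((q / 4 : ℕ) : ℝ) * (t / i)) (((q / 4 : ℕ) : ℝ) * (t / i) + t / i))
            (mesoRadius (n N)) σ η₃ ∧
          intMomentCapOn (Φ N) z (Set.Icc (((q / 4 : ℕ) : ℝ) * (t / i)) (((q / 4 : ℕ) : ℝ) * (t / i) + t / i)) (Kc i) ∧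
          ((i : ℝ) + 1)⁻¹ ^ 2 < |enDefect σ (Φ N) z (mesoRadius (n N)) (((q / 4 : ℕ) : ℝ) * (t / i)) (t / i)
            (fun r y => (2 * Λ)⁻¹ • ((((q / 4 : ℕ) : ℝ) * (t / i) + t / i - r) • lam4Row θ r y))|} :=
    ⟨_, fun _ _ _ => rfl⟩
  -- `G`-exponential smallness of every event, for each fixed grid size `i` (the closure K-stubs)
  have hEsmall : ∀ i, ∀ q < 4 * i, ∀ᶠ N in atTop,
      G N (E i q N) ≤ ENNReal.ofReal (Real.exp (-(c₀ * n N))) := by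
    intro i q hq
    have hj : q / 4 < i := by omega
    obtain h | h | h | h : q % 4 = 0 ∨ q % 4 = 1 ∨ q % 4 = 2 ∨ q % 4 = 3 := by omega
    · refine (hKmom (Kc i) (hKc i) 0 _ le_rfl (hw i _ hj).1 (hw i _ hj).2.2.2.1 _ (adm0 i _ hj).1 (adm0 i _ hj).2 _
        (hδ i)).mono fun N hN => ?_
      rw [hE, if_pos h]
      exact hN
    · refine (hKen (Kc i) (hKc i) 0 _ le_rfl (hw i _ hj).1 (hw i _ hj).2.2.2.1 _ (adm1 i _ hj).1
        (xx_abs_of_norm (adm1 i _ hj).2) _ (hδ i)).mono fun N hN => ?_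
      rw [hE, if_neg (show ¬q % 4 = 0 by omega), if_pos h]
      exact hN
    · refine (hKmom (Kc i) (hKc i) _ _ (hcl i _ hj).1 (hcl i _ hj).2.1 (hcl i _ hj).2.2.2.2.2.1 _ (adm2 i _ hj).1
        (adm2 i _ hj).2 _ (hδ i)).mono fun N hN => ?_
      rw [hE, if_neg (show ¬q % 4 = 0 by omega), if_neg (show ¬q % 4 = 1 by omega), if_pos h]
      exact hN
    · refine (hKen (Kc i) (hKc i) _ _ (hcl i _ hj).1 (hcl i _ hj).2.1 (hcl i _ hj).2.2.2.2.2.1 _ (adm3 i _ hj).1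
        (xx_abs_of_norm (adm3 i _ hj).2) _ (hδ i)).mono fun N hN => ?_
      rw [hE, if_neg (show ¬q % 4 = 0 by omega), if_neg (show ¬q % 4 = 1 by omega),
        if_neg (show ¬q % 4 = 2 by omega)]
      exact hN
  -- side conditions (`ℓ_N → 0`), cap failures, and (2) the engine: diagonal index and good events
  have hmeso : Tendsto (fun N => mesoRadius (n N)) atTop (nhds 0) :=
    (tendsto_rpow_neg_atTop (by norm_num : (0 : ℝ) < 1 / 4)).comp (tendsto_natCast_atTop_atTop.comp hn)
  have hp : ∀ i, ∀ᶠ N in atTop,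
      0 < mesoRadius (n N) ∧ mesoRadius (n N) < 1 / 2 ∧ mesoRadius (n N) < dd i := fun i =>
    ((hn.eventually_ge_atTop 1).mono fun N hN => show 0 < mesoRadius (n N) from
      Real.rpow_pos_of_pos (Nat.cast_pos.2 (Nat.lt_of_lt_of_le Nat.zero_lt_one hN)) _).and
      ((hmeso.eventually_lt_const (by norm_num)).and (hmeso.eventually_lt_const (hddpos i)))
  -- the INDEXED bad sets: speed-cap failure, packing-cap failure, integrated-cap failure at level `Kc i`; mass `≤ b i → 0`
  set B : (i N : ℕ) → Set (Config (n N) (Fin 3) T3) := fun i N =>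
    {z | ∃ r ∈ Set.Icc 0 t, ∃ x : T3,
        ηP < empiricalDensityField ((Φ N).flow r z) (ballKernel (mesoRadius (n N)) x) * σ ^ 3} ∪
      {z | ENNReal.ofReal (Kc i) < ∫⁻ r in Set.Icc 0 t,
        ENNReal.ofReal ((n N : ℝ)⁻¹ * ∑ i : Fin (n N), ‖((Φ N).flow r z i).2‖ ^ 4)} with hB_def
  set b : ℕ → ℝ≥0∞ := fun i => ENNReal.ofReal (1 / ((i : ℝ) + 1)) + ENNReal.ofReal (C₄ / Kc i) with hb_def
  have hb : Tendsto b atTop (nhds 0) := by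
    have h1 : Tendsto (fun i : ℕ => ENNReal.ofReal (1 / ((i : ℝ) + 1))) atTop (nhds 0) := by
      have := ENNReal.tendsto_ofReal (tendsto_one_div_add_atTop_nhds_zero_nat (𝕜 := ℝ))
      simpa using this
    have h2 : Tendsto (fun i : ℕ => ENNReal.ofReal (C₄ / Kc i)) atTop (nhds 0) := by
      have e : ∀ i : ℕ, C₄ / Kc i = (C₄ / (2 * (C₄ + 1))) * (1 / ((i : ℝ) + 1)) := fun i => by
        simp only [hKc_def]
        have : (0 : ℝ) < 2 * (C₄ + 1) := by positivity
        field_simp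
      have := (tendsto_one_div_add_atTop_nhds_zero_nat (𝕜 := ℝ)).const_mul (C₄ / (2 * (C₄ + 1)))
      rw [mul_zero] at this
      have := ENNReal.tendsto_ofReal this
      simpa only [e, ENNReal.ofReal_zero] using this
    have h := h1.add h2
    rw [add_zero] at h
    exact h
  have hBsmall : ∀ i, ∀ᶠ N in atTop, P N (B i N) ≤ b i := by
    intro i
    have hpos : (0 : ℝ≥0∞) < ENNReal.ofReal (1 / ((i : ℝ) + 1)) := ENNReal.ofReal_pos.2 (by positivity)
    filter_upwards [(tendsto_order.1 hW).2 _ hpos, hcapI (Kc i) (hKc i)] with N hN hcapN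
    calc P N (B i N) ≤ P N {z | ∃ r ∈ Set.Icc 0 t, ∃ x : T3,
              ηP < empiricalDensityField ((Φ N).flow r z) (ballKernel (mesoRadius (n N)) x) * σ ^ 3} +
            P N {z | ENNReal.ofReal (Kc i) < ∫⁻ r in Set.Icc 0 t,
              ENNReal.ofReal ((n N : ℝ)⁻¹ * ∑ i : Fin (n N), ‖((Φ N).flow r z i).2‖ ^ 4)} :=
          measure_union_le _ _
      _ ≤ b i := by
          rw [hb_def]
          exact add_le_add hN.le hcapN
  obtain ⟨ι, hι, hιp, G', hG'm, hG'P, hG'av⟩ := exists_goodEvents_of_importI P G n hn hac hImp (fun i => 4 * i)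
    E hEsmall (fun i N => 0 < mesoRadius (n N) ∧ mesoRadius (n N) < 1 / 2 ∧ mesoRadius (n N) < dd i) hp B b hb hBsmall
  refine ⟨Λ, hΛpos, ι, hι, G', hG'm, hG'P, ?_⟩
  -- (3) eventually in `N`: unpack
  filter_upwards [hιp, hG'av, hι.eventually_ge_atTop 1] with N hpN havN hι1
  obtain ⟨hmpos, hmhalf, hmdd⟩ := hpN
  refine ⟨Nat.lt_of_lt_of_le Nat.zero_lt_one hι1, hmpos, hmhalf, fun r hr x y hxy => ?_, fun z hz _ => ?_⟩
  · -- the modulus of the derivative fields at scale `ℓ_N < dd (ι N)`, moved from `[0, T')` to `[0, T)`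
    have hrT' : r ∈ Set.Ico 0 T' := ⟨hr.1, hr.2.trans_lt htT'⟩
    rw [hdd] at hmdd
    obtain ⟨-, h0t, h0x⟩ := hmod0 _ (he (ι N)) r hr x y (hxy.trans (hmdd.trans_le (min_le_left _ _)))
    obtain ⟨-, h1t, -⟩ := hmod1 _ (he (ι N)) r hr x y
      (hxy.trans (hmdd.trans_le ((min_le_right _ _).trans (min_le_left _ _))))
    obtain ⟨-, h4t, -⟩ := hmod4 _ (he (ι N)) r hr x y
      (hxy.trans (hmdd.trans_le ((min_le_right _ _).trans (min_le_right _ _))))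
    rw [← timeDerivWithin_Ico_eq_of_le hT'T (lam0Row σ ρ θ u) hrT' x,
      ← timeDerivWithin_Ico_eq_of_le hT'T (lam0Row σ ρ θ u) hrT' y,
      ← timeDerivWithin_Ico_eq_of_le hT'T (lamRow θ u) hrT' x,
      ← timeDerivWithin_Ico_eq_of_le hT'T (lamRow θ u) hrT' y,
      ← timeDerivWithin_Ico_eq_of_le hT'T (lam4Row θ) hrT' x,
      ← timeDerivWithin_Ico_eq_of_le hT'T (lam4Row θ) hrT' y]
    exact ⟨(Real.norm_eq_abs _).symm.trans_le h0t, h1t, (Real.norm_eq_abs _).symm.trans_le h4t,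
      fun k => (Real.norm_eq_abs _).symm.trans_le (h0x k)⟩
  · -- on the good event: caps on `[0, t]` (no cap failure); defect bounds (avoidance + linearity)
    have hzB := havN.1 hz
    simp only [hB_def, Set.mem_compl_iff, Set.mem_union, Set.mem_setOf_eq, not_or, not_exists, not_and,
      not_lt] at hzB
    have hpack : packCapOn (Φ N) z (Set.Icc 0 t) (mesoRadius (n N)) σ ηP := fun r hr x => hzB.1 r hr x
    have hmom : intMomentCapOn (Φ N) z (Set.Icc 0 t) (Kc (ι N)) := hzB.2
    have hav : ∀ q : ℕ, q < 4 * ι N → z ∉ E (ι N) q N := fun q hq => havN.2 q hq hz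
    refine ⟨hpack, fun k hk => ⟨?_, ?_⟩, fun j hj => ⟨?_, ?_⟩⟩
    · -- plain momentum row on the window `[0, (k+1) t/ι]`
      have h := hav (4 * k) (by omega)
      rw [hE, if_pos (show 4 * k % 4 = 0 by omega), show 4 * k / 4 = k by omega] at h
      simp only [Set.mem_setOf_eq, not_and, not_lt] at h
      exact (xx_mom_of_normalised (Φ N) z _ (hw _ k hk).1 hΛpos (adm0 _ k hk).1
        (h (fun r hr x => (hpack r ((hw _ k hk).2.2.2.2 hr) x).trans hη₂)
          (intMomentCapOn_mono hmom (hw _ k hk).2.2.2.2))).trans (xx_bound hΛpos _).1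
    · -- plain energy row on the window `[0, (k+1) t/ι]`
      have h := hav (4 * k + 1) (by omega)
      rw [hE, if_neg (show ¬(4 * k + 1) % 4 = 0 by omega), if_pos (show (4 * k + 1) % 4 = 1 by omega),
        show (4 * k + 1) / 4 = k by omega] at h
      simp only [Set.mem_setOf_eq, not_and, not_lt] at h
      exact (xx_en_of_normalised (Φ N) z _ (hw _ k hk).1 hΛpos (adm1 _ k hk).1
        (h (fun r hr x => (hpack r ((hw _ k hk).2.2.2.2 hr) x).trans hη₃)
          (intMomentCapOn_mono hmom (hw _ k hk).2.2.2.2))).trans (xx_bound hΛpos _).1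
    · -- time-weighted momentum row on the cell `[j t/ι, (j+1) t/ι]`
      have h := hav (4 * j + 2) (by omega)
      rw [hE, if_neg (show ¬(4 * j + 2) % 4 = 0 by omega), if_neg (show ¬(4 * j + 2) % 4 = 1 by omega),
        if_pos (show (4 * j + 2) % 4 = 2 by omega), show (4 * j + 2) / 4 = j by omega] at h
      simp only [Set.mem_setOf_eq, not_and, not_lt] at h
      exact (xx_mom_of_normalised (Φ N) z _ (hcl _ j hj).2.1 h2Λ (adm2 _ j hj).1
        (h (fun r hr x => (hpack r ((hcl _ j hj).2.2.2.2.2.2 hr) x).trans hη₂)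
          (intMomentCapOn_mono hmom (hcl _ j hj).2.2.2.2.2.2))).trans_eq (xx_bound hΛpos _).2
    · -- time-weighted energy row on the cell `[j t/ι, (j+1) t/ι]`
      have h := hav (4 * j + 3) (by omega)
      rw [hE, if_neg (show ¬(4 * j + 3) % 4 = 0 by omega), if_neg (show ¬(4 * j + 3) % 4 = 1 by omega),
        if_neg (show ¬(4 * j + 3) % 4 = 2 by omega), show (4 * j + 3) / 4 = j by omega] at h
      simp only [Set.mem_setOf_eq, not_and, not_lt] at h
      exact (xx_en_of_normalised (Φ N) z _ (hcl _ j hj).2.1 h2Λ (adm3 _ j hj).1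
        (h (fun r hr x => (hpack r ((hcl _ j hj).2.2.2.2.2.2 hr) x).trans hη₃)
          (intMomentCapOn_mono hmom (hcl _ j hj).2.2.2.2.2.2))).trans_eq (xx_bound hΛpos _).2


end Summit.AtomisticToContinuum.HydrodynamicLimit.Theorems.NearConstantShortTimeHL

end
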